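import Summits.AtomisticToContinuum.Crystallization.Theses.IsometryAtoms

/-!
# Birth skeleton (BC3) for crux `IsometryAtoms.PeriodicSupportToHinge`
# (item stmt-AtomisticToContinuum-15779 · route `route-AtomisticToContinuum-IsometryAtoms` · rank 9 · glue, size M)

CRUX = `PeriodicSupportToHinge := PS → BS → EL → HINGE`, the shared glue `SupportToHinge`
(stmt-AtomisticToContinuum-12748 of route `BenjaminiSchrammPeriodicSupport`) with its three
antecedents and its consequent INLINED:
* `PS`    — every minimising (`E_P[h_LJ] ≤ e* := ⨅_Q e(Q)`), point-stationary, a.s. `δ`-hard-core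
  probability law `P` on rooted configurations of `ℝ³` charges, for ONE periodic `Q` and at every
  scale `(R, ε)`, the two-way matching event `T_Q(R, ε)` = "after a linear isometry `A` and a base
  point `q ∈ Q.points`, the atoms of `μ` in `B_R` are two-way `ε`-matched with `A(Q.points − q)`"
  with positive (outer) `P`-measure;
* `BS`    — the Benjamini–Schramm limit of ground states (item 9230, PROVED in tree as
  `benjaminiSchrammLimit_proof`, a hypothesis here): a subsequence `φ`, a hard core `δ`, a
  point-stationary probability law `P` with `E(φ j)/φ j → E_P[h_LJ]` and the DENSITY-TRANSFER
  clause "`ρ < P(T)` ⇒ eventually in `j` at least `ρ·φ j` particles `i` of `x^(φ j)` whose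
  recentred configuration `(x_k − x_i)_k` is two-way `(R, ε)`-matched with the atoms of some
  `ν ∈ T`", for EVERY set `T` of configurations;
* `EL`    — `E(N)/N → e*` (item 0626, PROVED in tree);
* `HINGE` — `GroundStatesChargePeriodic` (stmt-2911): every Lennard-Jones ground-state sequence
  charges ONE periodic `Q` with density `ρ > 0` at every scale `(R, ε)`, frequently in `N`.

THE LINE (the portmanteau / density-transfer bookkeeping recorded on 12748 — grounder g39-22,
refuter rreview-0815T18-31 — with the WLOG-free parameter choice: radius `R + ε/2` and tolerance
`ε/2` on BOTH the law side and the transfer side). Given ground states `x`, take `φ, δ, P` from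
`BS`; uniqueness of limits along `φ` (`EL ∘ φ`) makes `P` minimising (proved inline); `PS` gives
the periodic `Q`; for a scale `(R, ε)` put `T := T_Q(R + ε/2, ε/2)`, so `P T > 0`; then
* `stub_windowTransfer` (deterministic geometry, size M) — TWO TWO-WAY MATCHINGS COMPOSE: if the
  atoms of `ν` are two-way `(R + ε/2, ε/2)`-matched with `A(Λ − q)` and the recentred configuration
  `(x_k − x_i)_k` is two-way `(R + ε/2, ε/2)`-matched with the atoms of `ν`, then the
  `R`-neighbourhood of `x_i` is two-way `ε`-matched with `x_i + A(Λ − q)` (triangle inequality;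
  the intermediate partner of a point of norm `≤ R` has norm `≤ R + ε/2`, and `‖A v‖ = ‖v‖`).
  Stated for an arbitrary point set `Λ` and base point `q` (used with `Λ = Q.points`).
* `stub_densityHandover` (portmanteau / density transfer along a subsequence, size M) — from
  `0 < P T` (`P` a probability law, so `0 < P(T).toReal`), the transfer clause at every
  `ρ < P(T).toReal` for a counted index predicate `S`, and a pointwise inclusion `S ⊆ S'`, produce
  `ρ := P(T).toReal/2 > 0` with `ρ·N ≤ #{i : S' N i}` FREQUENTLY in `N` (eventually along `φ`,
  `Nat.card` monotone under the inclusion on the finite type `Fin (φ j)`, and `φ → ∞` because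
  `StrictMono φ`).
`PeriodicSupportToHinge_of_stubs : stub₁ → stub₂ → (body of the crux)` is PROVED below (the
inclusion `S ⊆ S'` fed to stub₂ is exactly stub₁ applied under the binders) and
`PeriodicSupportToHinge_of : PeriodicSupportToHinge` (BY NAME) applies it to the two stubs; the
only sorries of the file are the two `stub_*`.

Measurability (the item's recorded why-might-fail) is NOT needed: `PS` and the transfer clause of
`BS` both speak of the OUTER measure `P T` of an ARBITRARY set `T`, so the hand-over is formal.

Disproof used: none on file at 2026-08-17 (`ledger crux ls stmt-AtomisticToContinuum-15779`: no
workfiles — no Disproof.lean, no Negative lemmas, no crux ideas; `ledger negatives --problem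
AtomisticToContinuum`: 20 refuted statements, the four of this sub-problem — GappedShellCensus
15929, SpectralChargeLedger 17253, BrittleMieDescent 4146, OneGrainWindow 3506 — concern shell
censuses / multiplier pricing / an effective local Hales bound / grain gluing, none a glue, hinge
or window-composition statement, so neither stub is an instance of a refuted statement).

BC3 probes (folder `bc/`, 2026-08-17, maxHeartbeats 400000, `first | exact? | simpa | simpa [..] |
aesop` and one example per tactic): `stub → PeriodicSupportToHinge` and `stub → Crystallization`
FAIL for both stubs (rc 1: `exact?` "could not close the goal" / whnf timeout, `simpa`
"assumption failed", `aesop` "failed to prove the goal after exhaustive search"; for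
`stub_windowTransfer` every 400k-heartbeat probe ends in a whnf timeout while simp normalises the
`EuclideanSpace` hypothesis, and at 2 000 000 heartbeats `simpa` / `aesop` fail explicitly).
-/

noncomputable section

open MeasureTheory Filter
open scoped ENNReal Topology
open Literature.MathematicalPhysics.StatisticalMechanics
open Literature.Probability.Process

namespace Summit.AtomisticToContinuum.Crystallization.Cruxes.PeriodicSupportToHinge.Birth

/-! ## Registered stubs (the only sorries of the file) -/

/-- **Stub 1 — window transfer: two two-way matchings compose (deterministic geometry).** Let
`Λ ⊂ ℝ³`, `q ∈ ℝ³`, `ε > 0`, a finite configuration `x : Fin N → ℝ³` with a marked particle `i`,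
a configuration-measure `ν` and a linear isometry `A`. If (law side) every point `s ∈ Λ` with
`dist s q ≤ R + ε/2` has an atom of `ν` within `ε/2` of `A(s − q)` and every atom of `ν` of norm
`≤ R + ε/2` is within `ε/2` of some `A(s − q)`, `s ∈ Λ`; and (transfer side) every atom of `ν` of
norm `≤ R + ε/2` is within `ε/2` of some difference `x_k − x_i` and every difference `x_k − x_i`
of norm `≤ R + ε/2` is within `ε/2` of an atom of `ν` — then the `R`-neighbourhood of `x_i` in
`x` is two-way `ε`-matched with `x_i + A(Λ − q)` (the finite-`N` clause of the hinge at `i`).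
Why true: triangle inequality twice; a partner of a point of norm `≤ R` at distance `≤ ε/2` has
norm `≤ R + ε/2`, and `‖A(s − q)‖ = dist s q`. Size: M (unpacking, `norm_sub_rev`,
`LinearIsometry.norm_map`, `dist_triangle`). [folklore; the finite-window form of local weak
convergence — item sources AldousSteele2004, AldousLyons2007] -/
theorem stub_windowTransfer :
    ∀ (Λ : Set (EuclideanSpace ℝ (Fin 3))) (q : EuclideanSpace ℝ (Fin 3)) (R ε : ℝ), 0 < ε →
      ∀ (N : ℕ) (x : Fin N → EuclideanSpace ℝ (Fin 3)) (i : Fin N)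
        (ν : Measure (EuclideanSpace ℝ (Fin 3)))
        (A : EuclideanSpace ℝ (Fin 3) →ₗᵢ[ℝ] EuclideanSpace ℝ (Fin 3)),
        (∀ s ∈ Λ, dist s q ≤ R + ε / 2 →
          ∃ y : EuclideanSpace ℝ (Fin 3), ν {y} ≠ 0 ∧ dist y (A (s - q)) ≤ ε / 2) →
        (∀ y : EuclideanSpace ℝ (Fin 3), ν {y} ≠ 0 → ‖y‖ ≤ R + ε / 2 →
          ∃ s ∈ Λ, dist y (A (s - q)) ≤ ε / 2) →
        (∀ p : EuclideanSpace ℝ (Fin 3), ν {p} ≠ 0 → ‖p‖ ≤ R + ε / 2 →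
          ∃ d ∈ Set.range (fun k : Fin N => x k - x i), dist d p ≤ ε / 2) →
        (∀ d ∈ Set.range (fun k : Fin N => x k - x i), ‖d‖ ≤ R + ε / 2 →
          ∃ p : EuclideanSpace ℝ (Fin 3), ν {p} ≠ 0 ∧ dist d p ≤ ε / 2) →
        (∀ s ∈ Λ, dist s q ≤ R → ∃ j : Fin N, dist (x j) (x i + A (s - q)) ≤ ε) ∧
        (∀ j : Fin N, dist (x j) (x i) ≤ R → ∃ s ∈ Λ, dist (x j) (x i + A (s - q)) ≤ ε) := by
  sorry

/-- **Stub 2 — density hand-over along the Benjamini–Schramm subsequence (portmanteau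
bookkeeping).** Let `P` be a probability law on configurations, `T` an event of positive (outer)
`P`-measure, `φ` a strictly increasing subsequence, and `S ⊆ S'` two families of index predicates
on `Fin N`. If for every `ρ < P(T).toReal` eventually in `j` at least `ρ·φ(j)` indices of
`Fin (φ j)` satisfy `S`, then for some `ρ > 0`, FREQUENTLY in `N`, at least `ρ·N` indices of
`Fin N` satisfy `S'`. Why true: `P T ≤ 1 < ∞` and `0 < P T` give `0 < P(T).toReal`; take
`ρ := P(T).toReal / 2`; `Nat.card {i // S (φ j) i} ≤ Nat.card {i // S' (φ j) i}` on the finite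
type `Fin (φ j)` (`Nat.card_le_card_of_injective` with `Subtype.map id`); an `atTop`-eventual
statement along `φ` is `atTop`-frequent in `N` because `StrictMono φ ⇒ Tendsto φ atTop atTop`
(`Filter.Tendsto.frequently`, `Filter.Eventually.frequently`). Size: M (ENNReal ↔ ℝ, filters,
`Nat.card`). [folklore; the portmanteau step of local weak convergence — item sources
AldousLyons2007, AldousSteele2004] -/
theorem stub_densityHandover :
    ∀ (P : Measure (Measure (EuclideanSpace ℝ (Fin 3)))), IsProbabilityMeasure P →
      ∀ (T : Set (Measure (EuclideanSpace ℝ (Fin 3)))), 0 < P T →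
      ∀ (φ : ℕ → ℕ), StrictMono φ →
      ∀ (S S' : (N : ℕ) → Fin N → Prop), (∀ (N : ℕ) (i : Fin N), S N i → S' N i) →
        (∀ ρ : ℝ, ρ < (P T).toReal → ∀ᶠ j : ℕ in Filter.atTop,
          ρ * (φ j : ℝ) ≤ (Nat.card {i : Fin (φ j) // S (φ j) i} : ℝ)) →
        ∃ ρ : ℝ, 0 < ρ ∧ ∃ᶠ N : ℕ in Filter.atTop,
          ρ * (N : ℝ) ≤ (Nat.card {i : Fin N // S' N i} : ℝ) := by
  sorry

/-! ## The assembly (sorry-free): stub₁ → stub₂ → the crux -/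

/-- **The crux from the two stub STATEMENTS** (implication form; the conclusion is the body of
`IsometryAtoms.PeriodicSupportToHinge` verbatim, so that the ONLY theorem of this file concluding
the crux BY NAME is `PeriodicSupportToHinge_of` below, as the skeleton audit requires). Given
ground states `x`: `BS` gives `φ, δ, P` with the hard-core, point-stationarity, energy and
density-transfer clauses; `EL` along `φ` and uniqueness of limits make `P` minimising; `PS` gives
the periodic `Q`; at scale `(R, ε)` the event `T := T_Q(R + ε/2, ε/2)` has `P T > 0`; stub 2, fed
with the transfer clause at `(T, R + ε/2, ε/2)` and with the inclusion "matched to some `ν ∈ T`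
⇒ matched to `Q`" (which is stub 1 under the binders), returns the hinge's density clause. -/
theorem PeriodicSupportToHinge_of_stubs :
    (∀ (Λ : Set (EuclideanSpace ℝ (Fin 3))) (q : EuclideanSpace ℝ (Fin 3)) (R ε : ℝ), 0 < ε →
      ∀ (N : ℕ) (x : Fin N → EuclideanSpace ℝ (Fin 3)) (i : Fin N)
        (ν : Measure (EuclideanSpace ℝ (Fin 3)))
        (A : EuclideanSpace ℝ (Fin 3) →ₗᵢ[ℝ] EuclideanSpace ℝ (Fin 3)),
        (∀ s ∈ Λ, dist s q ≤ R + ε / 2 →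
          ∃ y : EuclideanSpace ℝ (Fin 3), ν {y} ≠ 0 ∧ dist y (A (s - q)) ≤ ε / 2) →
        (∀ y : EuclideanSpace ℝ (Fin 3), ν {y} ≠ 0 → ‖y‖ ≤ R + ε / 2 →
          ∃ s ∈ Λ, dist y (A (s - q)) ≤ ε / 2) →
        (∀ p : EuclideanSpace ℝ (Fin 3), ν {p} ≠ 0 → ‖p‖ ≤ R + ε / 2 →
          ∃ d ∈ Set.range (fun k : Fin N => x k - x i), dist d p ≤ ε / 2) →
        (∀ d ∈ Set.range (fun k : Fin N => x k - x i), ‖d‖ ≤ R + ε / 2 →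
          ∃ p : EuclideanSpace ℝ (Fin 3), ν {p} ≠ 0 ∧ dist d p ≤ ε / 2) →
        (∀ s ∈ Λ, dist s q ≤ R → ∃ j : Fin N, dist (x j) (x i + A (s - q)) ≤ ε) ∧
        (∀ j : Fin N, dist (x j) (x i) ≤ R → ∃ s ∈ Λ, dist (x j) (x i + A (s - q)) ≤ ε)) →
    (∀ (P : Measure (Measure (EuclideanSpace ℝ (Fin 3)))), IsProbabilityMeasure P →
      ∀ (T : Set (Measure (EuclideanSpace ℝ (Fin 3)))), 0 < P T →
      ∀ (φ : ℕ → ℕ), StrictMono φ →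
      ∀ (S S' : (N : ℕ) → Fin N → Prop), (∀ (N : ℕ) (i : Fin N), S N i → S' N i) →
        (∀ ρ : ℝ, ρ < (P T).toReal → ∀ᶠ j : ℕ in Filter.atTop,
          ρ * (φ j : ℝ) ≤ (Nat.card {i : Fin (φ j) // S (φ j) i} : ℝ)) →
        ∃ ρ : ℝ, 0 < ρ ∧ ∃ᶠ N : ℕ in Filter.atTop,
          ρ * (N : ℝ) ≤ (Nat.card {i : Fin N // S' N i} : ℝ)) →
    -- the crux `IsometryAtoms.PeriodicSupportToHinge`, body verbatim: PS → BS → EL → HINGE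
    (∀ δ : ℝ, 0 < δ → ∀ P : Measure (Measure (EuclideanSpace ℝ (Fin 3))), IsProbabilityMeasure P →
      (∀ᵐ μ ∂P, IsRootedHardCore δ μ) → IsPointStationaryLaw P →
      (∫ μ, rootEnergy lennardJones μ ∂P) ≤
        (⨅ Q : PeriodicConfiguration 3, Q.energyPerParticle lennardJones) →
      ∃ Q : PeriodicConfiguration 3, ∀ R ε : ℝ, 0 < R → 0 < ε →
        0 < P {μ | ∃ A : EuclideanSpace ℝ (Fin 3) →ₗᵢ[ℝ] EuclideanSpace ℝ (Fin 3), ∃ q ∈ Q.points,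
          (∀ s ∈ Q.points, dist s q ≤ R →
            ∃ y : EuclideanSpace ℝ (Fin 3), μ {y} ≠ 0 ∧ dist y (A (s - q)) ≤ ε) ∧
          (∀ y : EuclideanSpace ℝ (Fin 3), μ {y} ≠ 0 → ‖y‖ ≤ R →
            ∃ s ∈ Q.points, dist y (A (s - q)) ≤ ε)}) →
    (∀ x : (N : ℕ) → (Fin N → EuclideanSpace ℝ (Fin 3)), (∀ N, IsGroundState lennardJones (x N)) →
      ∃ φ : ℕ → ℕ, StrictMono φ ∧ ∃ δ : ℝ, 0 < δ ∧
        ∃ P : Measure (Measure (EuclideanSpace ℝ (Fin 3))), IsProbabilityMeasure P ∧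
          (∀ᵐ μ ∂P, IsRootedHardCore δ μ) ∧ IsPointStationaryLaw P ∧
          Filter.Tendsto (fun j : ℕ => groundStateEnergy lennardJones 3 (φ j) / (φ j : ℝ))
            Filter.atTop (nhds (∫ μ, rootEnergy lennardJones μ ∂P)) ∧
          ∀ T : Set (Measure (EuclideanSpace ℝ (Fin 3))), ∀ R ε : ℝ, 0 < ε → ∀ ρ : ℝ,
            ρ < (P T).toReal → ∀ᶠ j : ℕ in Filter.atTop, ρ * (φ j : ℝ) ≤
              (Nat.card {i : Fin (φ j) // ∃ ν ∈ T,
                ((∀ p : EuclideanSpace ℝ (Fin 3), ν {p} ≠ 0 → ‖p‖ ≤ R →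
                    ∃ q ∈ (Set.range (fun k : Fin (φ j) => x (φ j) k - x (φ j) i)), dist q p ≤ ε) ∧
                  (∀ q ∈ (Set.range (fun k : Fin (φ j) => x (φ j) k - x (φ j) i)), ‖q‖ ≤ R →
                    ∃ p : EuclideanSpace ℝ (Fin 3), ν {p} ≠ 0 ∧ dist q p ≤ ε))} : ℝ)) →
    (Filter.Tendsto (fun N : ℕ => groundStateEnergy lennardJones 3 N / N) Filter.atTop
      (nhds (⨅ Q : PeriodicConfiguration 3, Q.energyPerParticle lennardJones))) →
    ∀ x : (N : ℕ) → (Fin N → EuclideanSpace ℝ (Fin 3)), (∀ N, IsGroundState lennardJones (x N)) →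
      ∃ Q : PeriodicConfiguration 3, ∀ R ε : ℝ, 0 < R → 0 < ε → ∃ ρ : ℝ, 0 < ρ ∧
        ∃ᶠ N : ℕ in Filter.atTop, ρ * (N : ℝ) ≤ (Nat.card {i : Fin N //
          ∃ A : EuclideanSpace ℝ (Fin 3) →ₗᵢ[ℝ] EuclideanSpace ℝ (Fin 3), ∃ q ∈ Q.points,
            (∀ s ∈ Q.points, dist s q ≤ R → ∃ j : Fin N, dist (x N j) (x N i + A (s - q)) ≤ ε) ∧
            (∀ j : Fin N, dist (x N j) (x N i) ≤ R →
              ∃ s ∈ Q.points, dist (x N j) (x N i + A (s - q)) ≤ ε)} : ℝ) := by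
  intro hWT hDH hPS hBS hEL x hx
  -- the Benjamini–Schramm limit of the ground states along a subsequence (hypothesis `BS`)
  obtain ⟨φ, hφ, δ, hδ, P, hP, hcore, hstat, hE, htr⟩ := hBS x hx
  -- the limit law is minimising: `E_P[h] = lim E(φ j)/φ j = ⨅ e` (hypothesis `EL` along `φ`)
  have hlim' : Filter.Tendsto (fun j : ℕ => groundStateEnergy lennardJones 3 (φ j) / (φ j : ℝ))
      Filter.atTop (nhds (⨅ Q : PeriodicConfiguration 3, Q.energyPerParticle lennardJones)) :=
    hEL.comp hφ.tendsto_atTop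
  have hEq := tendsto_nhds_unique hE hlim'
  -- periodic support of the minimising law (hypothesis `PS`)
  obtain ⟨Q, hQ⟩ := hPS δ hδ P hP hcore hstat hEq.le
  refine ⟨Q, fun R ε hR hε => ?_⟩
  -- the law-level matching event at radius `R + ε/2`, tolerance `ε/2`
  set T : Set (Measure (EuclideanSpace ℝ (Fin 3))) :=
    {μ | ∃ A : EuclideanSpace ℝ (Fin 3) →ₗᵢ[ℝ] EuclideanSpace ℝ (Fin 3), ∃ q ∈ Q.points,
      (∀ s ∈ Q.points, dist s q ≤ R + ε / 2 →
        ∃ y : EuclideanSpace ℝ (Fin 3), μ {y} ≠ 0 ∧ dist y (A (s - q)) ≤ ε / 2) ∧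
      (∀ y : EuclideanSpace ℝ (Fin 3), μ {y} ≠ 0 → ‖y‖ ≤ R + ε / 2 →
        ∃ s ∈ Q.points, dist y (A (s - q)) ≤ ε / 2)} with hTdef
  have hT : 0 < P T := hQ (R + ε / 2) (ε / 2) (by positivity) (by positivity)
  -- stub 2: density hand-over, with the transfer clause of `BS` at `(T, R + ε/2, ε/2)`
  refine hDH P hP T hT φ hφ
    (fun N i => ∃ ν ∈ T,
      (∀ p : EuclideanSpace ℝ (Fin 3), ν {p} ≠ 0 → ‖p‖ ≤ R + ε / 2 →
        ∃ q ∈ (Set.range (fun k : Fin N => x N k - x N i)), dist q p ≤ ε / 2) ∧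
      (∀ q ∈ (Set.range (fun k : Fin N => x N k - x N i)), ‖q‖ ≤ R + ε / 2 →
        ∃ p : EuclideanSpace ℝ (Fin 3), ν {p} ≠ 0 ∧ dist q p ≤ ε / 2))
    (fun N i => ∃ A : EuclideanSpace ℝ (Fin 3) →ₗᵢ[ℝ] EuclideanSpace ℝ (Fin 3), ∃ q ∈ Q.points,
      (∀ s ∈ Q.points, dist s q ≤ R → ∃ j : Fin N, dist (x N j) (x N i + A (s - q)) ≤ ε) ∧
      (∀ j : Fin N, dist (x N j) (x N i) ≤ R →
        ∃ s ∈ Q.points, dist (x N j) (x N i + A (s - q)) ≤ ε))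
    ?_ (htr T (R + ε / 2) (ε / 2) (by positivity))
  -- the pointwise inclusion of the counted index sets is stub 1 under the binders
  intro N i hi
  obtain ⟨ν, hνT, hc, hd⟩ := hi
  obtain ⟨A, q, hq, ha, hb⟩ := hνT
  obtain ⟨he, hf⟩ := hWT Q.points q R ε hε N (x N) i ν A ha hb hc hd
  exact ⟨A, q, hq, he, hf⟩

/-- **The skeleton concludes the crux BY NAME**: the two registered stubs fed into
`PeriodicSupportToHinge_of_stubs`; no sorry of its own (the file's sorries are exactly the two
`stub_*`). -/
theorem PeriodicSupportToHinge_of :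
    Summit.AtomisticToContinuum.Crystallization.Theses.IsometryAtoms.PeriodicSupportToHinge :=
  PeriodicSupportToHinge_of_stubs stub_windowTransfer stub_densityHandover

end Summit.AtomisticToContinuum.Crystallization.Cruxes.PeriodicSupportToHinge.Birth

end
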